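import Summits.NavierStokesRegularity.NavierStokesRegularity.Theorems.ExtremiserTransienceNearExtremalTransienceExtremiserLiouvilleNoAnalyticExtremalResidue
import Summits.NavierStokesRegularity.NavierStokesRegularity.Theorems.ExtremiserTransienceKStarAttainedHalfSpaceVariation
import HarnessLib

/-!
# Crux `ExtremiserTransience.NearExtremalTransience` (stmt-NavierStokesRegularity-21883), line `extremiser_liouville`,
# stub K1b — TOOLS FOR THE CONSTANT-SPEED CASE: one-sided first variation (extended class) and the far field

`--supports stmt-NavierStokesRegularity-21883` (helper).  Author: prover seat `ns-el-k1b` (g2).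

After `…ExtremiserLiouvillePlateau` the registered stub K1b is equivalent to «no analytic CONSTANT-SPEED extended
extremiser».  This file provides the two tools for attacking that case:

* `ext_firstVariation_le_of_oneSided_normBound` — the ONE-SIDED first variation of an extended extremiser
  (`‖v + εφ‖ ≤ (1 + mε)M` only for `0 ≤ ε < ε₀`; conclusion `S·J₁(φ) ≤ κ⋆²M²(m Z W + W a₁(φ) + Z c₁(φ))`); port of
  `DepletionLadder.KStar.HalfSpace.firstVariation_le_of_oneSided_normBound` with admissibility of `v + εφ` replaced by
  the extended sharp inequality `extendedSharp` (no `L²` hypothesis);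
* `exists_farField_of_constSpeed` — a constant-speed field `‖w‖ ≡ M` with `‖Dw‖ ≤ B`, `Dw ∈ L²` has a far-field value
  `c` with `‖c‖ = M`, `w − c → 0` at infinity, `w − c ∈ L⁶`, and the pointwise identities
  `⟪w x − c, c⟫ = −‖w x − c‖²/2`, `⟪w x, w x − c⟫ = ‖w x − c‖²/2`.

WHAT THIS IS NOT: statements about hypothetical extremisers; nothing here proves NS regularity. [folklore]
-/

noncomputable section

open Set Filter Topology MeasureTheory Metric Function
open scoped ENNReal NNReal Topology InnerProductSpace RealInnerProductSpace ContDiff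
open Literature.Analysis.FluidPDE Literature.Analysis

namespace Summit.NavierStokesRegularity.NavierStokesRegularity.Theorems

-- the problem directory repeats the summit name (`NavierStokesRegularity/NavierStokesRegularity`)
set_option linter.dupNamespace false

namespace ExtremiserLiouville

open DepletionLadder.KStar

variable {v φ : EuclideanSpace ℝ (Fin 3) → EuclideanSpace ℝ (Fin 3)}

/-- **One-sided first variation of an EXTENDED extremiser.**  If `‖v + εφ‖ ≤ (1 + mε)M` for `0 ≤ ε < ε₀`, then
`S·J₁(φ) ≤ κ⋆² M² (m Z W + W a₁(φ) + Z c₁(φ))`. [folklore] -/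
theorem ext_firstVariation_le_of_oneSided_normBound
    (hv : ContDiff ℝ ∞ v) (hdiv : VectorCalculus.IsDivFree v)
    {M B : ℝ} (hB : ∀ x, ‖fderiv ℝ v x‖ ≤ B)
    (h1 : ∫⁻ x, ‖iteratedFDeriv ℝ 1 v x‖ₑ ^ 2 < ⊤) (h2 : ∫⁻ x, ‖iteratedFDeriv ℝ 2 v x‖ₑ ^ 2 < ⊤)
    (hatt : |∫ x, ⟪curl v x, fderiv ℝ v x (curl v x)⟫| = (sInf {κ : ℝ | (∀ (v : EuclideanSpace ℝ (Fin 3) → EuclideanSpace ℝ (Fin 3)) (M B : ℝ), ContDiff ℝ (⊤ : ℕ∞) v → Literature.Analysis.FluidPDE.VectorCalculus.IsDivFree v → (∀ x, ‖v x‖ ≤ M) → (∀ x, ‖fderiv ℝ v x‖ ≤ B) → (∫⁻ x, ‖iteratedFDeriv ℝ 0 v x‖ₑ ^ 2 < ⊤) → (∫⁻ x, ‖iteratedFDeriv ℝ 1 v x‖ₑ ^ 2 < ⊤) → (∫⁻ x, ‖iteratedFDeriv ℝ 2 v x‖ₑ ^ 2 < ⊤) → |∫ x, ⟪Literature.Analysis.FluidPDE.curl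 v x, fderiv ℝ v x (Literature.Analysis.FluidPDE.curl v x)⟫_ℝ| ≤ κ * M * Real.sqrt (∫ x, ‖Literature.Analysis.FluidPDE.curl v x‖ ^ 2) * Real.sqrt (∫ x, Literature.Analysis.FluidPDE.frobeniusNormSq (fderiv ℝ (Literature.Analysis.FluidPDE.curl v) x)))}) * M * Real.sqrt (∫ x, ‖curl v x‖ ^ 2) * Real.sqrt (∫ x, frobeniusNormSq (fderiv ℝ (curl v) x)))
    (hφ : ContDiff ℝ ∞ φ) (hφc : HasCompactSupport φ) (hφdiv : VectorCalculus.IsDivFree φ)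
    {m ε₀ : ℝ} (hε₀ : 0 < ε₀) (hbound : ∀ ε : ℝ, 0 ≤ ε → ε < ε₀ → ∀ x, ‖v x + ε • φ x‖ ≤ (1 + m * ε) * M) :
    (∫ x, ⟪curl v x, fderiv ℝ v x (curl v x)⟫) * (∫ x, (⟪curl φ x, fderiv ℝ v x (curl v x)⟫ + ⟪curl v x, fderiv ℝ φ x (curl v x)⟫ + ⟪curl v x, fderiv ℝ v x (curl φ x)⟫)) ≤
      (sInf {κ : ℝ | (∀ (v : EuclideanSpace ℝ (Fin 3) → EuclideanSpace ℝ (Fin 3)) (M B : ℝ), ContDiff ℝ (⊤ : ℕ∞) v → Literature.Analysis.FluidPDE.VectorCalculus.IsDivFree v → (∀ x, ‖v x‖ ≤ M) → (∀ x, ‖fderiv ℝ v x‖ ≤ B) → (∫⁻ x, ‖iteratedFDeriv ℝ 0 v x‖ₑ ^ 2 < ⊤) → (∫⁻ x, ‖iteratedFDeriv ℝ 1 v x‖ₑ ^ 2 < ⊤) → (∫⁻ x, ‖iteratedFDeriv ℝ 2 v x‖ₑ ^ 2 < ⊤) → |∫ x, ⟪Literature.Analysis.FluidPDE.curl v x,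 fderiv ℝ v x (Literature.Analysis.FluidPDE.curl v x)⟫_ℝ| ≤ κ * M * Real.sqrt (∫ x, ‖Literature.Analysis.FluidPDE.curl v x‖ ^ 2) * Real.sqrt (∫ x, Literature.Analysis.FluidPDE.frobeniusNormSq (fderiv ℝ (Literature.Analysis.FluidPDE.curl v) x)))}) ^ 2 * M ^ 2 * (m * (∫ x, ‖curl v x‖ ^ 2) * (∫ x, frobeniusNormSq (fderiv ℝ (curl v) x)) + (∫ x, frobeniusNormSq (fderiv ℝ (curl v) x)) * (∫ x, ⟪curl v x, curl φ x⟫) + (∫ x, ‖curl v x‖ ^ 2) * (∫ x, ∑ i, ⟪fderiv ℝ (curl v) x (EuclideanSpace.basisFun (Fin 3) ℝ i), fderiv ℝ (curl φ) x (EuclideanSpace.basisFun (Fin 3) ℝ i)⟫)) := by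
  have hext := extendedSharp
  set K : ℝ := (sInf {κ : ℝ | (∀ (v : EuclideanSpace ℝ (Fin 3) → EuclideanSpace ℝ (Fin 3)) (M B : ℝ), ContDiff ℝ (⊤ : ℕ∞) v → Literature.Analysis.FluidPDE.VectorCalculus.IsDivFree v → (∀ x, ‖v x‖ ≤ M) → (∀ x, ‖fderiv ℝ v x‖ ≤ B) → (∫⁻ x, ‖iteratedFDeriv ℝ 0 v x‖ₑ ^ 2 < ⊤) → (∫⁻ x, ‖iteratedFDeriv ℝ 1 v x‖ₑ ^ 2 < ⊤) → (∫⁻ x, ‖iteratedFDeriv ℝ 2 v x‖ₑ ^ 2 < ⊤) → |∫ x, ⟪Literature.Analysis.FluidPDE.curl v x, fderiv ℝ v x (Literature.Analysis.FluidPDE.curl v x)⟫_ℝ| ≤ κ * M * Real.sqrt (∫ x, ‖Literature.Analysis.FluidPDE.curl v x‖ ^ 2) * Real.sqrt (∫ x, Literature.Analysis.FluidPDE.frobeniusNormSq (fderiv ℝ (Literature.Analysis.FluidPDE.curl v) x)))}) with hK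
  have hZ0 : 0 ≤ (∫ x, ‖curl v x‖ ^ 2) := integral_nonneg fun x => sq_nonneg _
  have hW0 : 0 ≤ (∫ x, frobeniusNormSq (fderiv ℝ (curl v) x)) := integral_nonneg fun x => frobeniusNormSq_nonneg _
  have hvd : Differentiable ℝ v := hv.differentiable (by simp)
  have hφd : Differentiable ℝ φ := hφ.differentiable (by simp)
  obtain ⟨C, hC⟩ := (hφ.continuous_fderiv (by simp)).bounded_above_of_compact_support (hφc.fderiv (𝕜 := ℝ))
  refine HalfSpace.linear_coeff_le_of_sq_le_oneSided hε₀
    (J₂ := ∫ x, (⟪curl φ x, fderiv ℝ φ x (curl v x)⟫ + ⟪curl φ x, fderiv ℝ v x (curl φ x)⟫ +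
      ⟪curl v x, fderiv ℝ φ x (curl φ x)⟫))
    (J₃ := ∫ x, ⟪curl φ x, fderiv ℝ φ x (curl φ x)⟫) (a₂ := ∫ x, ‖curl φ x‖ ^ 2)
    (c₂ := ∫ x, frobeniusNormSq (fderiv ℝ (curl φ) x)) ?_ fun ε hε0 hε => ?_
  · calc (∫ x, ⟪curl v x, fderiv ℝ v x (curl v x)⟫) ^ 2 = |∫ x, ⟪curl v x, fderiv ℝ v x (curl v x)⟫| ^ 2 := (sq_abs _).symm
      _ = (K * M * Real.sqrt (∫ x, ‖curl v x‖ ^ 2) * Real.sqrt (∫ x, frobeniusNormSq (fderiv ℝ (curl v) x))) ^ 2 := by rw [hatt]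
      _ = K ^ 2 * M ^ 2 * (∫ x, ‖curl v x‖ ^ 2) * (∫ x, frobeniusNormSq (fderiv ℝ (curl v) x)) := by
          rw [mul_pow, mul_pow, mul_pow, Real.sq_sqrt hZ0, Real.sq_sqrt hW0]
  · -- the perturbed field is in the extended class
    have hcd : ContDiff ℝ ∞ (fun y => v y + ε • φ y) := hv.add (hφ.const_smul ε)
    have hdv : VectorCalculus.IsDivFree (fun y => v y + ε • φ y) := fun x => by
      rw [divergence_add_smul hvd hφd, hdiv x, hφdiv x, mul_zero, add_zero]
    have hB' : ∀ x, ‖fderiv ℝ (fun y => v y + ε • φ y) x‖ ≤ B + |ε| * C := fun x => by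
      rw [fderiv_add_smul hvd hφd]
      calc ‖fderiv ℝ v x + ε • fderiv ℝ φ x‖ ≤ ‖fderiv ℝ v x‖ + ‖ε • fderiv ℝ φ x‖ := norm_add_le _ _
        _ = ‖fderiv ℝ v x‖ + |ε| * ‖fderiv ℝ φ x‖ := by rw [norm_smul, Real.norm_eq_abs]
        _ ≤ B + |ε| * C := add_le_add (hB x) (mul_le_mul_of_nonneg_left (hC x) (abs_nonneg ε))
    have h1' := lintegral_iteratedFDeriv_add_smul_lt_top hv hφ hφc ε h1
    have h2' := lintegral_iteratedFDeriv_add_smul_lt_top hv hφ hφc ε h2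
    have hu := hext _ ((1 + m * ε) * M) (B + |ε| * C) hcd hdv (hbound ε hε0 hε) hB' h1' h2'
    have hZε : 0 ≤ ∫ x, ‖curl (fun y => v y + ε • φ y) x‖ ^ 2 := integral_nonneg fun x => sq_nonneg _
    have hWε : 0 ≤ ∫ x, frobeniusNormSq (fderiv ℝ (curl (fun y => v y + ε • φ y)) x) :=
      integral_nonneg fun x => frobeniusNormSq_nonneg _
    have hsq : (∫ x, ⟪curl (fun y => v y + ε • φ y) x,
        fderiv ℝ (fun y => v y + ε • φ y) x (curl (fun y => v y + ε • φ y) x)⟫) ^ 2 ≤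
        (K * ((1 + m * ε) * M) * Real.sqrt (∫ x, ‖curl (fun y => v y + ε • φ y) x‖ ^ 2) *
          Real.sqrt (∫ x, frobeniusNormSq (fderiv ℝ (curl (fun y => v y + ε • φ y)) x))) ^ 2 := by
      rw [← sq_abs (∫ x, ⟪curl (fun y => v y + ε • φ y) x,
        fderiv ℝ (fun y => v y + ε • φ y) x (curl (fun y => v y + ε • φ y) x)⟫)]
      exact pow_le_pow_left₀ (abs_nonneg _) hu 2
    rw [mul_pow, mul_pow, mul_pow, Real.sq_sqrt hZε, Real.sq_sqrt hWε,
      integral_stretching_add_smul hv hB h1 hφ hφc ε, integral_normSq_curl_add_smul hv h1 hφ hφc ε,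
      integral_frobeniusNormSq_add_smul hv h2 hφ hφc ε] at hsq
    exact hsq

/-! ## The far field of a constant-speed field -/

/-- Algebra: `‖c + V‖ = ‖c‖` gives `⟪V, c⟫ = −‖V‖²/2` and `⟪c + V, V⟫ = ‖V‖²/2`. [folklore] -/
theorem inner_eq_of_norm_add_eq {c V : EuclideanSpace ℝ (Fin 3)} (h : ‖c + V‖ = ‖c‖) :
    ⟪V, c⟫ = -(‖V‖ ^ 2 / 2) ∧ ⟪c + V, V⟫ = ‖V‖ ^ 2 / 2 := by
  have hsq : ‖c + V‖ ^ 2 = ‖c‖ ^ 2 := by rw [h]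
  rw [norm_add_sq_real] at hsq
  have h1 : ⟪V, c⟫ = -(‖V‖ ^ 2 / 2) := by rw [real_inner_comm]; linarith
  refine ⟨h1, ?_⟩
  rw [inner_add_left, real_inner_comm V c, real_inner_self_eq_norm_sq, h1]
  ring

/-- **The far field of a constant-speed field.**  If `‖w‖ ≡ M`, `‖Dw‖ ≤ B` and `Dw ∈ L²`, there is `c` with `‖c‖ = M`,
`w − c → 0` at infinity, `w − c ∈ L⁶`, and `⟪w x − c, c⟫ = −‖w x − c‖²/2`, `⟪w x, w x − c⟫ = ‖w x − c‖²/2` for all `x`.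
[folklore] -/
theorem exists_farField_of_constSpeed {w : EuclideanSpace ℝ (Fin 3) → EuclideanSpace ℝ (Fin 3)} (hw : ContDiff ℝ 1 w)
    {M B : ℝ} (hM : ∀ x, ‖w x‖ = M) (hB : ∀ x, ‖fderiv ℝ w x‖ ≤ B) (hD : ∫⁻ x, ‖fderiv ℝ w x‖ₑ ^ 2 < ⊤) :
    ∃ c : EuclideanSpace ℝ (Fin 3), ‖c‖ = M ∧ Tendsto (fun x => w x - c) (cocompact (EuclideanSpace ℝ (Fin 3))) (𝓝 0) ∧
      MemLp (fun x => w x - c) 6 volume ∧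
      ∀ x, ⟪w x - c, c⟫ = -(‖w x - c‖ ^ 2 / 2) ∧ ⟪w x, w x - c⟫ = ‖w x - c‖ ^ 2 / 2 := by
  obtain ⟨c, -, hdec, hmem⟩ := exists_farFieldLimit hw (fun x => (hM x).le) hB hD
  -- `‖c‖ = M`: the norm of `w` is constantly `M` and `w → c` along the (nontrivial) cocompact filter
  have hcM : ‖c‖ = M := by
    have hwc : Tendsto w (cocompact (EuclideanSpace ℝ (Fin 3))) (𝓝 c) := by
      have h := hdec.add_const c
      simp only [sub_add_cancel, zero_add] at h
      exact h
    have hn : Tendsto (fun x => ‖w x‖) (cocompact (EuclideanSpace ℝ (Fin 3))) (𝓝 ‖c‖) := hwc.norm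
    have hn' : Tendsto (fun x => ‖w x‖) (cocompact (EuclideanSpace ℝ (Fin 3))) (𝓝 M) := by
      simp only [hM]; exact tendsto_const_nhds
    haveI : (cocompact (EuclideanSpace ℝ (Fin 3))).NeBot := cocompact_neBot_iff.2 inferInstance
    exact tendsto_nhds_unique hn hn'
  refine ⟨c, hcM, hdec, hmem, fun x => ?_⟩
  have h : ‖c + (w x - c)‖ = ‖c‖ := by rw [add_sub_cancel, hM x, hcM]
  have := inner_eq_of_norm_add_eq h
  rw [add_sub_cancel] at this
  exact this

end ExtremiserLiouville

end Summit.NavierStokesRegularity.NavierStokesRegularity.Theorems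

end
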